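import Summits.BirchSwinnertonDyer.Rank1Residual.F1Sign2.KuriharaLevelVanishingAtTwoProofs
import Literature.NumberTheory.EllipticCurves.AnalyticRankOrderProofs
import Literature.NumberTheory.EllipticCurves.LeadingTermPPartProofs
import HarnessLib

/-!
# Line `fkl` of crux `RankOneAtTwoBigImageOddLocal` (stmt-BirchSwinnertonDyer-23715, route ByReductionTypeAtTwo):
# the LEVEL-ONE, `ℓ ≡ 3 (mod 4)` corner of the hardest stub K2-F is a THEOREM — the Kurihara number vanishes

Lead prover seat `bsd-line-fkl-p1` (g0), helpers `--supports stmt-BirchSwinnertonDyer-23715` (registered stub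
`stub_katoFirstLayerLaw : F1Sign2.FirstLayerLawAtTwo`).  K2-F (a) asserts, for every `τ`-prime `ℓ` of level `k`
and every `ψ : (ℤ/ℓ)ˣ ↠ ℤ/2^k`, `δ'_k(ℓ; ψ) = ∑_u 2[u/ℓ]⁺_f ψ(u) ∈ 2^{min(k, s+1)} ℤ_{(2)}`.  At LEVEL ONE every odd prime
qualifies (`2 ∣ ℓ − 1`), `ψ` is the quadratic character read additively, and:

* `levelSumTwo_one_eq_sum` (pure modular symbols, any cusp form `f` of level `M ≥ 1`): if `ℓ ≡ 3 (mod 4)` then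
  `δ'_1(ℓ; ψ) = ∑_{u ∈ (ℤ/ℓ)ˣ} [u/ℓ]⁺_f` — because `−1` is a non-residue, `u ↦ −u` swaps the two `ψ`-buckets while
  `[−u/ℓ]⁺ = [u/ℓ]⁺` (evenness `ratPlusSymbol_neg` + periodicity `ratPlusSymbol_add_intCast_holds`, both PROVED in the tree);
* `levelSumTwo_one_eq_mul_ratPlusSymbol_zero`: for the newform `f` of `W` and `ℓ ∤ N_W`, `ℓ ≡ 3 (mod 4)`:
  `δ'_1(ℓ; ψ) = (a_ℓ − 2)·[0]⁺_f` (Hecke sum, the tree's PROVED `heckeSumAtPrimeLevel_holds`);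
* `ratPlusSymbol_zero_eq_zero_of_analyticRank_ne_zero`: `r_an(W) ≠ 0 ⇒ [0]⁺_f = 0` (`L(E,1) = [0]⁺ Ω⁺`, `Ω⁺ > 0`);
* `levelSumTwo_one_eq_zero`: hence in analytic rank `≥ 1`, `δ'_1(ℓ; ψ) = 0` for every such `ℓ`, and
  `firstLayerLawAtTwo_a_levelOne_of_mod_four_eq_three`: the conclusion of K2-F (a) at `(ℓ, k = 1)` holds for every
  `τ`-prime `ℓ ≡ 3 (mod 4)` of a curve of analytic rank one, for EVERY value of the parameter `s` — UNCONDITIONALLY;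
* `levelSumTwo_one_eq_sum_sub_twisted` (any odd `ℓ`): `δ'_1(ℓ; ψ) = ∑_u [u/ℓ]⁺ − ∑_u χ_ψ(u)[u/ℓ]⁺` with `χ_ψ = 1 − 2ψ ∈ {±1}`,
  so at `ℓ ≡ 1 (mod 4)` in analytic rank `≥ 1` the level-one content of K2-F (a) is exactly «the quadratic twisted symbol
  sum `∑ χ_ℓ(u)[u/ℓ]⁺ = L^{alg}(E^{(ℓ)}, 1)` (Birch) is EVEN at every `τ`-prime `ℓ ≡ 1 (mod 4)`» — the Tamagawa factor
  `c_ℓ(E^{(ℓ)}) = 2` of the twist dividing its algebraic `L`-value, BSD₂-predicted, open in print at `2` (census note).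
Theorems only; no `def`, no named-fact hypothesis, no `sorry`.  BSD is not proved by any of this.
-/

set_option autoImplicit false

noncomputable section

open scoped Classical MatrixGroups ModularForm

set_option linter.dupNamespace false

namespace Summit.BirchSwinnertonDyer.BirchSwinnertonDyer.Theorems.RankOneAtTwoFkl

open CongruenceSubgroup WeierstrassCurve Literature.NumberTheory.EllipticCurves
  Literature.NumberTheory.EllipticCurves.ModularForms Summit.BirchSwinnertonDyer.Rank1Residual.F1Sign2

/-! ## The two-element group `Multiplicative (ℤ/2)` and surjective `ψ : (ℤ/ℓ)ˣ → ℤ/2` -/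

/-- In a monoid, an element with `x·x = 1` equals each of its odd powers. [folklore] -/
theorem pow_eq_self_of_mul_self_eq_one {G : Type*} [Monoid G] (x : G) (hx : x * x = 1) {n : ℕ}
    (hn : Odd n) : x ^ n = x := by
  obtain ⟨m, rfl⟩ := hn
  rw [pow_succ, pow_mul, sq, hx, one_pow, one_mul]

/-- The two elements of `Multiplicative (ℤ/2^1)`: `1 = ofAdd 0` and `ofAdd 1`. [folklore] -/
theorem eq_one_or_eq_ofAdd_one (x : Multiplicative (ZMod (2 ^ 1))) :
    x = 1 ∨ x = Multiplicative.ofAdd 1 := by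
  revert x; decide

/-- **For `ℓ ≡ 3 (mod 4)` a surjective `ψ : (ℤ/ℓ)ˣ → ℤ/2` is non-trivial at `−1`** (`−1` is a quadratic
non-residue).  Proof without quadratic reciprocity: `ℓ/2` is odd, so `ψ(u) = ψ(u)^{ℓ/2} = ψ(u^{ℓ/2})` and
`u^{ℓ/2} = ±1` (Euler, `ZMod.pow_div_two_eq_neg_one_or_one`); were `ψ(−1) = 1`, `ψ` would be trivial. [folklore] -/
theorem apply_neg_one_eq_ofAdd_one {ℓ : ℕ} [Fact ℓ.Prime] (hℓ : ℓ % 4 = 3)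
    (ψ : (ZMod ℓ)ˣ →* Multiplicative (ZMod (2 ^ 1))) (hψ : Function.Surjective ψ) :
    ψ (-1) = Multiplicative.ofAdd 1 := by
  rcases eq_one_or_eq_ofAdd_one (ψ (-1)) with h1 | h1
  · exfalso
    have hodd : Odd (ℓ / 2) := by rw [Nat.odd_iff]; omega
    have hsq : ∀ x : Multiplicative (ZMod (2 ^ 1)), x * x = 1 := by decide
    have hall : ∀ u : (ZMod ℓ)ˣ, ψ u = 1 := by
      intro u
      have hu : (u : ZMod ℓ) ≠ 0 := u.ne_zero
      have hpow : u ^ (ℓ / 2) = 1 ∨ u ^ (ℓ / 2) = -1 := by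
        rcases ZMod.pow_div_two_eq_neg_one_or_one ℓ hu with h | h
        · left; exact Units.ext (by simpa using h)
        · right; exact Units.ext (by simpa using h)
      have key : ψ u = ψ (u ^ (ℓ / 2)) := by
        rw [map_pow, pow_eq_self_of_mul_self_eq_one _ (hsq _) hodd]
      rw [key]
      rcases hpow with h | h
      · rw [h, map_one]
      · rw [h, h1]
    obtain ⟨u, hu⟩ := hψ (Multiplicative.ofAdd 1)
    rw [hall u] at hu
    exact absurd hu (by decide)
  · exact h1

/-- The bucket values of a surjective `ψ : (ℤ/ℓ)ˣ → ℤ/2`, `ℓ ≡ 3 (mod 4)`, lifted to `{0, 1} ⊂ ℚ`: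
`ψ(−u) = 1 − ψ(u)`. [folklore] -/
theorem cast_val_toAdd_apply_neg {ℓ : ℕ} [Fact ℓ.Prime] (hℓ : ℓ % 4 = 3)
    (ψ : (ZMod ℓ)ˣ →* Multiplicative (ZMod (2 ^ 1))) (hψ : Function.Surjective ψ) (u : (ZMod ℓ)ˣ) :
    ((Multiplicative.toAdd (ψ (-u))).val : ℚ) = 1 - ((Multiplicative.toAdd (ψ u)).val : ℚ) := by
  have hneg : ψ (-u) = Multiplicative.ofAdd 1 * ψ u := by
    rw [← apply_neg_one_eq_ofAdd_one hℓ ψ hψ, ← map_mul, neg_one_mul]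
  have hv1 : (Multiplicative.toAdd (Multiplicative.ofAdd (1 : ZMod (2 ^ 1)))).val = 1 := by decide
  have hv0 : (Multiplicative.toAdd (1 : Multiplicative (ZMod (2 ^ 1)))).val = 0 := by decide
  have h11 : Multiplicative.ofAdd (1 : ZMod (2 ^ 1)) * Multiplicative.ofAdd (1 : ZMod (2 ^ 1)) = 1 := by decide
  rw [hneg]
  rcases eq_one_or_eq_ofAdd_one (ψ u) with h | h
  · rw [h, mul_one, hv1, hv0]; norm_num
  · rw [h, h11, hv1, hv0]; norm_num

/-! ## Level one, `ℓ ≡ 3 (mod 4)`: the Kurihara number is the plain symbol sum (pure modular symbols) -/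

/-- **`δ'_1(ℓ; ψ) = ∑_{u ∈ (ℤ/ℓ)ˣ} [u/ℓ]⁺_f` for `ℓ ≡ 3 (mod 4)`** (any cusp form `f` of level `M ≥ 1`, any
surjective `ψ : (ℤ/ℓ)ˣ → ℤ/2`).  Reindex the defining sum `∑ 2[u/ℓ]⁺ ψ(u)` by `u ↦ −u`: the symbol is unchanged
(`[(ℓ − a)/ℓ]⁺ = [−a/ℓ + 1]⁺ = [−a/ℓ]⁺ = [a/ℓ]⁺`, by the tree's PROVED periodicity `ratPlusSymbol_add_intCast_holds`
and evenness `ratPlusSymbol_neg`) while `ψ(−u) = 1 − ψ(u)`; adding the two expressions gives `2δ' = 2∑[u/ℓ]⁺`.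
[folklore] -/
theorem levelSumTwo_one_eq_sum {M : ℕ} [NeZero M] (f : CuspForm (Gamma0 M) 2) {ℓ : ℕ} [Fact ℓ.Prime]
    (hℓ : ℓ % 4 = 3) (ψ : (ZMod ℓ)ˣ →* Multiplicative (ZMod (2 ^ 1))) (hψ : Function.Surjective ψ) :
    levelSumTwo f ℓ 1 ψ = ∑ u : (ZMod ℓ)ˣ, ratPlusSymbol f ((((u : ZMod ℓ).val : ℚ)) / ℓ) := by
  have hper : ∀ (r : ℚ) (n : ℤ), ratPlusSymbol f (r + n) = ratPlusSymbol f r :=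
    fun r n => ratPlusSymbol_add_intCast_holds (f := f) r n
  -- the symbol is invariant under `u ↦ -u`
  have hsym : ∀ u : (ZMod ℓ)ˣ,
      ratPlusSymbol f (((((-u : (ZMod ℓ)ˣ) : ZMod ℓ).val : ℚ)) / ℓ) =
        ratPlusSymbol f ((((u : ZMod ℓ).val : ℚ)) / ℓ) := by
    intro u
    have hu : (u : ZMod ℓ) ≠ 0 := u.ne_zero
    have hval : ((-u : (ZMod ℓ)ˣ) : ZMod ℓ).val = ℓ - (u : ZMod ℓ).val := by
      rw [Units.val_neg, ZMod.neg_val, if_neg hu]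
    have hle : (u : ZMod ℓ).val ≤ ℓ := (ZMod.val_lt _).le
    rw [hval, Nat.cast_sub hle]
    have : (((ℓ : ℚ) - ((u : ZMod ℓ).val : ℚ)) / ℓ) = -((((u : ZMod ℓ).val : ℚ)) / ℓ) + (1 : ℤ) := by
      have hℓ0 : (ℓ : ℚ) ≠ 0 := by exact_mod_cast (Fact.out : ℓ.Prime).ne_zero
      push_cast; field_simp; ring
    rw [this, hper, ratPlusSymbol_neg]
  unfold levelSumTwo
  set S := ∑ u : (ZMod ℓ)ˣ, 2 * ratPlusSymbol f ((((u : ZMod ℓ).val : ℚ)) / ℓ) *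
    (((Multiplicative.toAdd (ψ u)).val : ℕ) : ℚ) with hS
  have hreindex : S = ∑ u : (ZMod ℓ)ˣ, 2 * ratPlusSymbol f ((((u : ZMod ℓ).val : ℚ)) / ℓ) *
      (1 - (((Multiplicative.toAdd (ψ u)).val : ℕ) : ℚ)) := by
    rw [hS, ← Equiv.sum_comp (Equiv.neg (ZMod ℓ)ˣ)]
    refine Finset.sum_congr rfl fun u _ => ?_
    rw [Equiv.neg_apply, hsym u, cast_val_toAdd_apply_neg hℓ ψ hψ u]
  have h2 : S + S = ∑ u : (ZMod ℓ)ˣ, 2 * ratPlusSymbol f ((((u : ZMod ℓ).val : ℚ)) / ℓ) := by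
    conv_lhs => rw [hS]; arg 2; rw [← hS, hreindex]
    rw [← Finset.sum_add_distrib]
    refine Finset.sum_congr rfl fun u _ => ?_
    ring
  have : S = (∑ u : (ZMod ℓ)ˣ, 2 * ratPlusSymbol f ((((u : ZMod ℓ).val : ℚ)) / ℓ)) / 2 := by
    rw [← h2]; ring
  rw [this, ← Finset.mul_sum]
  ring

/-- **`δ'_1(ℓ; ψ) = ∑_u [u/ℓ]⁺ − ∑_u χ_ψ(u)[u/ℓ]⁺` at any odd prime `ℓ`** (any cusp form `f`, any `ψ : (ℤ/ℓ)ˣ → ℤ/2`),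
where `χ_ψ(u) := 1 − 2ψ(u) ∈ {±1}` is `ψ` read multiplicatively: the level-one Kurihara number is the plain symbol sum
minus the `χ_ψ`-twisted symbol sum (for `ψ` onto, `χ_ψ` is the quadratic character mod `ℓ` and the twisted sum is Birch's
`L^{alg}(f ⊗ χ_ℓ, 1)` up to the Gauss-sum unit).  Pure algebra: `2ψ = 1 − χ_ψ`. [folklore] -/
theorem levelSumTwo_one_eq_sum_sub_twisted {M : ℕ} (f : CuspForm (Gamma0 M) 2) {ℓ : ℕ} [NeZero ℓ]
    (ψ : (ZMod ℓ)ˣ →* Multiplicative (ZMod (2 ^ 1))) :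
    levelSumTwo f ℓ 1 ψ =
      (∑ u : (ZMod ℓ)ˣ, ratPlusSymbol f ((((u : ZMod ℓ).val : ℚ)) / ℓ)) -
      ∑ u : (ZMod ℓ)ˣ, (1 - 2 * (((Multiplicative.toAdd (ψ u)).val : ℕ) : ℚ)) *
        ratPlusSymbol f ((((u : ZMod ℓ).val : ℚ)) / ℓ) := by
  unfold levelSumTwo
  rw [← Finset.sum_sub_distrib]
  refine Finset.sum_congr rfl fun u _ => ?_
  ring

/-! ## With the curve: Hecke sum, `[0]⁺ = 0` in positive analytic rank, and the K2-F (a) corner -/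

/-- **`δ'_1(ℓ; ψ) = (a_ℓ(W) − 2)·[0]⁺_f`** for the newform `f` of `W` (any level `M`), a prime `ℓ ∤ N_W` with
`ℓ ≡ 3 (mod 4)`, and any surjective `ψ : (ℤ/ℓ)ˣ → ℤ/2`: `levelSumTwo_one_eq_sum` and the Hecke sum
`∑_u [u/ℓ]⁺ = (a_ℓ − 2)[0]⁺` (the tree's PROVED `heckeSumAtPrimeLevel_holds`, Mazur–Tate–Teitelbaum 1986 (4.2)).
[cite: MazurTateTeitelbaum1986Invent, §I.4 (4.2)] -/
theorem levelSumTwo_one_eq_mul_ratPlusSymbol_zero (W : WeierstrassCurve ℚ) [W.IsElliptic] [W.IsGloballyMinimal]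
    {M : ℕ} [NeZero M] (f : CuspForm (Gamma0 M) 2) (hf : IsNewformOf W f) {ℓ : ℕ} [Fact ℓ.Prime]
    (hN : Nat.Coprime (W.conductorNorm ℤ) ℓ) (hℓ : ℓ % 4 = 3)
    (ψ : (ZMod ℓ)ˣ →* Multiplicative (ZMod (2 ^ 1))) (hψ : Function.Surjective ψ) :
    levelSumTwo f ℓ 1 ψ = ((W.frobeniusTrace ℓ : ℚ) - 2) * ratPlusSymbol f 0 := by
  rw [levelSumTwo_one_eq_sum f hℓ ψ hψ, heckeSumAtPrimeLevel_holds W f hf ℓ hN]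

/-- **`r_an(W) ≠ 0 ⇒ [0]⁺_f = 0`** for the newform `f` of `W`: `L(W, s)` is entire (`IsNewformOf.hasEntireLFunction`),
`r_an = 0 ↔ L(W,1) ≠ 0` (`analyticRank_eq_zero_iff_holds`), and `[0]⁺_f · Ω⁺_f = L(W,1)` with `Ω⁺_f > 0`
(`IsNewformOf.ratPlusSymbol_zero_mul_plusPeriod`, `IsNewform0.plusPeriod_pos_holds`) — all PROVED in the tree.
[cite: MazurTateTeitelbaum1986Invent, §I.8 (8.6)] -/
theorem ratPlusSymbol_zero_eq_zero_of_analyticRank_ne_zero (W : WeierstrassCurve ℚ) [W.IsElliptic]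
    {M : ℕ} [NeZero M] (f : CuspForm (Gamma0 M) 2) (hf : IsNewformOf W f) (hr : W.analyticRank ≠ 0) :
    ratPlusSymbol f 0 = 0 := by
  have hL : W.entireLFunction 1 = 0 := by
    by_contra hL
    exact hr ((analyticRank_eq_zero_iff_holds (W := W) hf.hasEntireLFunction).mpr hL)
  have hpos : 0 < plusPeriod f := IsNewform0.plusPeriod_pos_holds hf.1 hf.coeffField_eq_bot
  have h1 := hf.ratPlusSymbol_zero_mul_plusPeriod
  rw [hL, Complex.zero_re] at h1
  have h2 : ((ratPlusSymbol f 0 : ℚ) : ℝ) = 0 := (mul_eq_zero.mp h1).resolve_right hpos.ne'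
  exact_mod_cast h2

/-- **In positive analytic rank the level-one Kurihara number VANISHES at every `ℓ ≡ 3 (mod 4)`:**
for the newform `f` of `W` with `r_an(W) ≠ 0`, a prime `ℓ ∤ N_W`, `ℓ ≡ 3 (mod 4)`, and any surjective
`ψ : (ℤ/ℓ)ˣ → ℤ/2`: `δ'_1(ℓ; ψ) = 0`.  UNCONDITIONAL (`levelSumTwo_one_eq_mul_ratPlusSymbol_zero` and `[0]⁺ = 0`).
[cite: MazurTateTeitelbaum1986Invent, §I.4 (4.2) and §I.8 (8.6)] -/
theorem levelSumTwo_one_eq_zero (W : WeierstrassCurve ℚ) [W.IsElliptic] [W.IsGloballyMinimal]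
    {M : ℕ} [NeZero M] (f : CuspForm (Gamma0 M) 2) (hf : IsNewformOf W f) (hr : W.analyticRank ≠ 0)
    {ℓ : ℕ} [Fact ℓ.Prime] (hN : Nat.Coprime (W.conductorNorm ℤ) ℓ) (hℓ : ℓ % 4 = 3)
    (ψ : (ZMod ℓ)ˣ →* Multiplicative (ZMod (2 ^ 1))) (hψ : Function.Surjective ψ) :
    levelSumTwo f ℓ 1 ψ = 0 := by
  rw [levelSumTwo_one_eq_mul_ratPlusSymbol_zero W f hf hN hℓ ψ hψ,
    ratPlusSymbol_zero_eq_zero_of_analyticRank_ne_zero W f hf hr, mul_zero]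

/-- A `τ`-prime is prime to the conductor: `IsLevelAtTwo W ℓ` (`ℓ ∤ 2N_W`, …) gives `Nat.Coprime N_W ℓ`. [folklore] -/
theorem coprime_conductorNorm_of_isLevelAtTwo (W : WeierstrassCurve ℚ) [W.IsElliptic] [W.IsGloballyMinimal]
    {ℓ : ℕ} [Fact ℓ.Prime] (hlev : IsLevelAtTwo W ℓ) : Nat.Coprime (W.conductorNorm ℤ) ℓ := by
  have hℓ : ℓ.Prime := Fact.out
  have h := (hlev.2 ℓ (dvd_refl ℓ)).1
  have hnd : ¬ ℓ ∣ W.conductorNorm ℤ := fun hd => h (dvd_mul_of_dvd_right hd 2)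
  exact (Nat.Prime.coprime_iff_not_dvd hℓ).mpr hnd |>.symm

/-- **K2-F (a) at `(ℓ, k = 1)` for `ℓ ≡ 3 (mod 4)` — UNCONDITIONAL, for every parameter `s`.**  In the setting of the
hardest stub `F1Sign2.FirstLayerLawAtTwo` (here only: `W/ℚ` globally minimal of analytic rank one — as on the slice of
crux `RankOneAtTwoBigImageOddLocal` — and `f` its newform at any level), for every `τ`-prime `ℓ` (`IsLevelAtTwo W ℓ`)
with `ℓ ≡ 3 (mod 4)` and every surjective `ψ : (ℤ/ℓ)ˣ → ℤ/2^1`, the level-one Kurihara number lies in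
`2^{min(1, s+1)} ℤ_{(2)}` for EVERY `s : ℕ` — because it is `0` (`levelSumTwo_one_eq_zero`).  The remaining level-one
content of K2-F (a) sits at the `τ`-primes `ℓ ≡ 1 (mod 4)`, where by `levelSumTwo_one_eq_sum_sub_twisted` it reads
«the quadratic twisted symbol sum is even» (census note in the file header). [conjecture] corner, kernel theorem. -/
theorem firstLayerLawAtTwo_a_levelOne_of_mod_four_eq_three (W : WeierstrassCurve ℚ) [W.IsElliptic]
    [W.IsGloballyMinimal] {M : ℕ} [NeZero M] (f : CuspForm (Gamma0 M) 2) (hf : IsNewformOf W f)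
    (han : W.analyticRank = 1) (s : ℕ) (ℓ : ℕ) [Fact ℓ.Prime] (hlev : IsLevelAtTwo W ℓ) (hℓ : ℓ % 4 = 3)
    (ψ : (ZMod ℓ)ˣ →* Multiplicative (ZMod (2 ^ 1))) (hψ : Function.Surjective ψ) :
    InTwoPowZLoc (min 1 (s + 1)) (levelSumTwo f ℓ 1 ψ) := by
  rw [levelSumTwo_one_eq_zero W f hf (by rw [han]; exact one_ne_zero)
    (coprime_conductorNorm_of_isLevelAtTwo W hlev) hℓ ψ hψ]
  exact ⟨0, by simp, by simp⟩

end Summit.BirchSwinnertonDyer.BirchSwinnertonDyer.Theorems.RankOneAtTwoFkl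

end
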